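import Summits.HubbardSuperconductivity.HubbardLadder.PairCorrSectorCert
import Summits.HubbardSuperconductivity.HubbardLadder.PairCorrWindowOfOpBounds
import Summits.HubbardSuperconductivity.HubbardLadder.PairFieldCeilingUniform
import Summits.HubbardSuperconductivity.HubbardLadder.Bounds.SlaterUpperBounds
import Literature.MathematicalPhysics.QuantumLattice.HubbardNNNHoppingRectSymmetries
import HarnessLib

/-!
# Rung R3 — the `pair_dd` LIST consumer (engines docket F-pairdd-1) of SECTOR-mode (finite-torus) observable
# certificates (part 2 of 2; part 1 = `PairCorrSectorCert`: the all-classes edge and `TorusSectorObsCertTT'`)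

HONEST FRAMING (page 1): ladder R1–R4 with certified numbers; no claim on H/H₀. This pair of files proves
SOUNDNESS EDGES and types ONE certificate-data structure; no certificate of the kind they consume
exists (no `pair_dd` instance has been run by anyone; result line (iii) of record, verbatim: no R3
instance has been run; no dichotomy is certified at any size; there are no brackets to overlap).

FILE SPLIT: §1–§2 live in `Summits.HubbardSuperconductivity.HubbardLadder.PairCorrSectorCert` (imported); §3–§4
below in THIS module. One docstring, two modules (the 400-line cap).

WHY THIS FILE. The engines' `pair_dd` objective kind (FORMAT-certsdp1 §9 addendum, rev 2, LIST form
`Σᵢ λᵢ V_{rᵢ}`; readers A and B wired against this cell's sixteen test vectors) is admitted ONLY in the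
SETTING "finite torus, `hypotheses.mode = sector`, `objective = total_plus`" (its P-1). A §9 certificate is
the exact identity, in the CAR algebra of the torus,
  `O − E·1 − κ (u·1 − H) = S + Σ_r λ_r O_r + (charged residual monomials) + (neutral residual monomials)`,
`S` a Gram sum of squares, `O_r` ∈ {commutators `[H, m]` of the PHYSICAL `H`, two-sided sector-ideal rows
`(N̂ − N) m`, `m (N̂ − N)`, `(S^z − M) m`, `m (S^z − M)`}, `κ ≥ 0` the multiplier of the one `energy_upper`
inequality `ω(H) ≤ u`, and `E_cert = E − Σ_{neutral α ≠ 1} |p_α|` (FORMAT §3 sector CLASS and BOUND, §7, §9).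
The tree's consumers of this shape are (a) the ENERGY objective (`TorusSectorCertTT'`,
`minEnergyOn_szSector_ge_of_sector_certificate`: every class, tracial sector ground state) and (b) the
Literature §9 correlator edge `re_dotProduct_ge_of_sector_certificate_ineq_of_eigenvector_of_energy_le`,
which is stated for the PURE graph Hamiltonian `hamiltonian G t U` (`t' = 0`) and the `N̂`-ideal only;
the cell's R2 rows `re_expect_sectorGS_ge_of_windowCertificate(_symm)` have no slots for charged words,
anti-Hermitian parts or the `Σ |p_α|` residual of a ROUNDED certificate. The first instance the lead may
name, `pairrows-N14-min` (`4 × 4`, `U = 8`, `N = 14`, `t' = −1/4`), therefore had no consumer. This file: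

* §1 `re_expect_ge_of_sectorObsCertificate` — GENERIC over a finite orbital lattice: ANY Hermitian `A`,
  any unit `ψ ∈ szSector N M` with `A ψ = E ψ`, `E ≤ u`, `0 ≤ κ`, and the identity above with every class
  (Gram, commutators with `A`, both sector ideals two-sided, charged ladder words, anti-Hermitian parts,
  neutral residual ladder words) ⇒ `c − Σ ‖aₖ‖ ≤ Re ⟨ψ, X ψ⟩`; `…_of_sectorGS` — the same for every
  `IsGroundStateInSector A N M ψ` given `A.minEnergyOn (szSector N M) ≤ u`. NO symmetry-identification
  class: a vector state is not symmetric (FORMAT §9: the producer's group only AVERAGES multipliers; the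
  identity is checked as written), so nothing is assumed about the objective's invariance.
* §2 `TorusSectorObsCertTT' L t t' U N M u X q` — the certificate DATA for the `t–t'` torus
  `hubbardTorusTT' L t t' U` (field layout of `Bounds.TorusSectorLowerRows.TorusSectorCertTT'` minus the
  identification family, plus `κ`, `hκ`), the energy hypothesis constant `u` and the objective `X` IN THE
  TYPE; edges `.re_expect_ge_of_eigenvector`, `.re_expect_ge` (every sector ground state).
* §3 the `pair_dd` list objective `pairListObjective L lam r = Σᵢ λᵢ V_{rᵢ}`,
  `V_r = pairCorrSym L r = ½ (O_r + O_rᴴ)`, `O_r = pairCorrOp L r = Σ_x Δ_x† Δ_{x+r}` (R3-PAIRROWS-SPEC §2 =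
  addendum P-2); `Re ⟨ψ, Σᵢ λᵢ V_{rᵢ} ψ⟩ = L² Σᵢ λᵢ P̄_d(L, rᵢ; ψ)`; two single-entry certificates (`λ = ±1`)
  ⇒ the R3 row `PairCorrWindowCert` with window `[q₊/L², −q₋/L²]` (`PairCorrWindowCert.ofSectorPairCerts`);
  a list certificate representing a block `S` (`hrep`, as in `UpperBlockListCertTT'`) with `λᵢ = −wᵢ`
  ⇒ the finite-size ceiling `p_d(L; ψ) ≤ −q / (|S|² L²)` on every sector ground state (block Cauchy–Schwarz,
  `card_sq_mul_pairFieldDensity_le_sum_avgPairCorr`).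
* §4 the energy-hypothesis glue: a typed UPPER claim `groundEnergy (hubbardRectTorusTT' L L t t' U) (2 nh) ≤ u`
  (the shape of the cell's T-UP / Slater / LUC leaves) ⇒ `minEnergyOn (szSector (2 nh) 0) ≤ u`
  (`groundEnergy_hubbardTorusTT'_eq_rect`, Lieb's `S^z = 0` representative); the `4 × 4`, `U = 8`, `N = 14`,
  `t' = −1/4` chain end to end, and its calibration against the in-tree node `Bounds.slaterUpper_4x4_U8_N14_tpm1o4_uhf`.

Every hypothesis is a binder or a structure field; nothing about the Hubbard ground state is assumed; no
number is introduced. A concrete certificate enters the tree exactly as the energy rows do: a claim node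
`Nonempty (TorusSectorObsCertTT' 4 1 (-1/4) 8 14 0 u (pairListObjective 4 lam r) q)` whose evidence is the
verifier-B-passed file, plus the typed upper claim discharging `u`.

## References
* J. Wang et al., *Certifying ground-state properties of many-body systems*, PRX 14 (2024) 031006,
  §3 eq. (obsopt) (energy-constrained relaxation of a finite cluster). [cite: WangEtAl2024, §3 eq. (obsopt)]
* X. Han, *Quantum many-body bootstrap*, arXiv:2006.06002 (2020), §2 eq. (2)–(4) (charges, ideals,
  stationarity). [cite: Han2020Bootstrap, §2 eq. (2)–(4)]
* I. Kull, N. Schuch, B. Dive, M. Navascués, PRX 14 (2024) 021008, §5.3 (rounded certificates).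
  [cite: KullEtAl2024, §5.3]
* M. Qin et al., PRX 10 (2020) 031016, §II eqs. (2)–(4) (the `d`-wave pair correlator). [cite: QinEtAl2020, §II eqs. (2)–(4)]
* E. H. Lieb, PRL 62 (1989) 1201, proof of Thm 1 (`S^z = 0` representatives). [cite: LiebPRL1989]
* Cell documents: `run/shared/lean/pub/pub-mbboot/certs/FORMAT-certsdp1.md` §3, §7, §9;
  `run/shared/lean/engines/code/certsdp/docs/FORMAT-certsdp1-addendum-pairdd-draft.md` (rev 2) P-1–P-6;
  `pub-hubbard-r3/R3-PAIRROWS-SPEC.md` §2, §5, §10.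
-/

noncomputable section

namespace Summit.HubbardSuperconductivity.HubbardLadder

open Matrix Finset Literature.MathematicalPhysics.QuantumLattice Literature.Probability.LatticeModels
open scoped ComplexOrder

section Torus

variable {L : ℕ} [NeZero L]

/-- (Local to this file, as in `PairCorrSectorCert` / `Bounds.TorusSectorLowerRows`.) Torus sites are compared
through the linear order. [folklore] -/
local instance (priority := high) instDecidableEqFermionTorusPairSectorRows :
    DecidableEq (FermionTorus 2 L) :=
  LinearOrder.toDecidableEq

/-! ## §3 The `pair_dd` list objective and its consumers (R3 row; finite-size order-parameter ceiling) -/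

/-- `V_r = ½ (O_r + O_rᴴ)`, the Hermitian part of `O_r = pairCorrOp L r = Σ_x Δ_x† Δ_{x+r}` — the operator
of the `pair_dd` kind at displacement `r` (addendum P-2 = R3-PAIRROWS-SPEC §2: `V_δ = (O_δ + O_{−δ})/2`,
`O_δ^* = O_{−δ}`). [cite: QinEtAl2020, §II eqs. (2)–(4)] -/
def pairCorrSym (L : ℕ) [NeZero L] (r : Site 2) :
    Matrix (Finset (Orb (FermionTorus 2 L))) (Finset (Orb (FermionTorus 2 L))) ℂ :=
  ((1 / 2 : ℝ) : ℂ) • (pairCorrOp L r + (pairCorrOp L r)ᴴ)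

/-- The LIST objective `Σᵢ λᵢ V_{rᵢ}` of a `pair_dd` entry list `[(rᵢ, λᵢ)]` (addendum P-1). [folklore] -/
def pairListObjective (L : ℕ) [NeZero L] {n : ℕ} (lam : Fin n → ℝ) (r : Fin n → Site 2) :
    Matrix (Finset (Orb (FermionTorus 2 L))) (Finset (Orb (FermionTorus 2 L))) ℂ :=
  ∑ i, ((lam i : ℝ) : ℂ) • pairCorrSym L (r i)

/-- `Re ⟨ψ, V_r ψ⟩ = Re ⟨ψ, O_r ψ⟩` (`⟨ψ, O_rᴴ ψ⟩` is the conjugate of `⟨ψ, O_r ψ⟩`). [folklore] -/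
theorem re_expect_pairCorrSym (r : Site 2) (ψ : Fock (Orb (FermionTorus 2 L))) :
    (star ψ ⬝ᵥ pairCorrSym L r *ᵥ ψ).re = (star ψ ⬝ᵥ pairCorrOp L r *ᵥ ψ).re := by
  have h0 : (star ψ ⬝ᵥ (pairCorrOp L r)ᴴ *ᵥ ψ).re = (star ψ ⬝ᵥ pairCorrOp L r *ᵥ ψ).re := by
    have h := vectorState_re_conjTranspose_sub ψ (pairCorrOp L r)
    rw [Literature.MathematicalPhysics.QuantumManyBody.StateRelaxation.vectorState_apply, sub_mulVec,
      dotProduct_sub, Complex.sub_re, sub_eq_zero] at h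
    exact h
  rw [pairCorrSym, smul_mulVec, dotProduct_smul, add_mulVec, dotProduct_add, smul_eq_mul,
    Complex.re_ofReal_mul, Complex.add_re, h0]
  ring

/-- **The list objective evaluates to the R3 quantities**: on side `m + 1`,
`Re ⟨ψ, Σᵢ λᵢ V_{rᵢ} ψ⟩ = (m+1)² Σᵢ λᵢ P̄_d(m+1, rᵢ; ψ)`. [cite: QinEtAl2020, §II eqs. (2)–(4)] -/
theorem re_expect_pairListObjective (m : ℕ) {n : ℕ} (lam : Fin n → ℝ) (r : Fin n → Site 2)
    (ψ : Fock (Orb (FermionTorus 2 (m + 1)))) :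
    (star ψ ⬝ᵥ pairListObjective (m + 1) lam r *ᵥ ψ).re =
      ((m + 1 : ℕ) : ℝ) ^ 2 * ∑ i, lam i * avgPairCorr (m + 1) (r i) ψ := by
  have hL2 : (0 : ℝ) < ((m + 1 : ℕ) : ℝ) ^ 2 := by positivity
  rw [pairListObjective, sum_mulVec, dotProduct_sum, Complex.re_sum, Finset.mul_sum]
  refine Finset.sum_congr rfl fun i _ => ?_
  rw [smul_mulVec, dotProduct_smul, smul_eq_mul, Complex.re_ofReal_mul, re_expect_pairCorrSym,
    avgPairCorr_eq_re_expect_pairCorrOp m (r i) ψ]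
  field_simp

/-- `(m+1)² P̄_d(m+1, r; ψ) = Re ⟨ψ, O_r ψ⟩` (`avgPairCorr_eq_re_expect_pairCorrOp`, cleared). [folklore] -/
theorem sq_mul_avgPairCorr (m : ℕ) (r : Site 2) (ψ : Fock (Orb (FermionTorus 2 (m + 1)))) :
    ((m + 1 : ℕ) : ℝ) ^ 2 * avgPairCorr (m + 1) r ψ = (star ψ ⬝ᵥ pairCorrOp (m + 1) r *ᵥ ψ).re := by
  have hL2 : (0 : ℝ) < ((m + 1 : ℕ) : ℝ) ^ 2 := by positivity
  rw [avgPairCorr_eq_re_expect_pairCorrOp, mul_div_cancel₀ _ hL2.ne']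

/-- Single entry: `Re ⟨ψ, (λ • V_r) ψ⟩ = λ · Re ⟨ψ, O_r ψ⟩`. [folklore] -/
theorem re_expect_pairListObjective_single (m : ℕ) (lam : ℝ) (r : Site 2)
    (ψ : Fock (Orb (FermionTorus 2 (m + 1)))) :
    (star ψ ⬝ᵥ pairListObjective (m + 1) (fun _ : Fin 1 => lam) (fun _ => r) *ᵥ ψ).re =
      lam * (star ψ ⬝ᵥ pairCorrOp (m + 1) r *ᵥ ψ).re := by
  rw [re_expect_pairListObjective, ← sq_mul_avgPairCorr]
  simp only [Finset.univ_unique, Fin.default_eq_zero, Finset.sum_singleton]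
  ring

/-- **R3 row from two single-entry `pair_dd` certificates** (`λ = +1` with value `q₊`, `λ = −1` with value
`q₋`, same displacement `r`, same sector `(N (m+1), S^z = 0)`, energy hypotheses `u₊`, `u₋` each dominating
the sector ground energy): the `PairCorrWindowCert` row with window `[q₊/(m+1)², −q₋/(m+1)²]` for the family
`hubbardTorusTT' · t t' U` (`PairCorrWindowCert.ofPairCorrOpBounds`, p201144). HONEST FRAMING: ladder R1–R4
with certified numbers; no claim on H/H₀. [cite: QinEtAl2020, §II eqs. (2)–(4)] -/
def PairCorrWindowCert.ofSectorPairCerts (m : ℕ) (t t' U : ℝ) (N : ℕ → ℕ) (r : Site 2)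
    {up um qp qm : ℝ}
    (Cp : TorusSectorObsCertTT' (m + 1) t t' U (N (m + 1)) 0 up
      (pairListObjective (m + 1) (fun _ : Fin 1 => (1 : ℝ)) (fun _ => r)) qp)
    (Cm : TorusSectorObsCertTT' (m + 1) t t' U (N (m + 1)) 0 um
      (pairListObjective (m + 1) (fun _ : Fin 1 => (-1 : ℝ)) (fun _ => r)) qm)
    (hEp : (hubbardTorusTT' (m + 1) t t' U).minEnergyOn (szSector (N (m + 1)) 0) ≤ up)
    (hEm : (hubbardTorusTT' (m + 1) t t' U).minEnergyOn (szSector (N (m + 1)) 0) ≤ um) :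
    PairCorrWindowCert (fun L => hubbardTorusTT' L t t' U) N (m + 1) r :=
  PairCorrWindowCert.ofPairCorrOpBounds (H := fun L => hubbardTorusTT' L t t' U) (N := N) m r qp (-qm)
    (fun ψ h1 hgs => by
      have h := Cp.re_expect_ge hEp ψ h1 hgs
      rw [re_expect_pairListObjective_single, one_mul] at h
      exact h)
    (fun ψ h1 hgs => by
      have h := Cm.re_expect_ge hEm ψ h1 hgs
      rw [re_expect_pairListObjective_single, neg_one_mul] at h
      linarith)

/-- The window of `PairCorrWindowCert.ofSectorPairCerts`, for the record: `[q₊/(m+1)², −q₋/(m+1)²]`.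
[folklore] -/
theorem PairCorrWindowCert.ofSectorPairCerts_lo_hi (m : ℕ) (t t' U : ℝ) (N : ℕ → ℕ) (r : Site 2)
    {up um qp qm : ℝ}
    (Cp : TorusSectorObsCertTT' (m + 1) t t' U (N (m + 1)) 0 up
      (pairListObjective (m + 1) (fun _ : Fin 1 => (1 : ℝ)) (fun _ => r)) qp)
    (Cm : TorusSectorObsCertTT' (m + 1) t t' U (N (m + 1)) 0 um
      (pairListObjective (m + 1) (fun _ : Fin 1 => (-1 : ℝ)) (fun _ => r)) qm)
    (hEp : (hubbardTorusTT' (m + 1) t t' U).minEnergyOn (szSector (N (m + 1)) 0) ≤ up)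
    (hEm : (hubbardTorusTT' (m + 1) t t' U).minEnergyOn (szSector (N (m + 1)) 0) ≤ um) :
    (PairCorrWindowCert.ofSectorPairCerts m t t' U N r Cp Cm hEp hEm).lo = qp / ((m + 1 : ℕ) : ℝ) ^ 2 ∧
      (PairCorrWindowCert.ofSectorPairCerts m t t' U N r Cp Cm hEp hEm).hi = -qm / ((m + 1 : ℕ) : ℝ) ^ 2 :=
  ⟨rfl, rfl⟩

/-- **Finite-size order-parameter ceiling from ONE `pair_dd` LIST certificate** (R3-PAIRROWS-SPEC §10(b)).
A nonempty block `S ⊂ ℤ²`, a representing list `(wᵢ, rᵢ)` (`Σ_{s,s' ∈ S} F(s' − s) = Σᵢ wᵢ F(rᵢ)` for every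
`F`, e.g. the displacement multiset of `S − S`; `hrep_single`, `hrep_pair` in `PairFieldCeilingListBlocks`),
and a sector certificate with value `q` for the UPPER list objective `Σᵢ (−wᵢ) V_{rᵢ}` give, for every unit
ground state `ψ` of the joint sector `(N, S^z = M)` of `hubbardTorusTT' (m+1) t t' U` (energy hypothesis
`minEnergyOn ≤ u`): `p_d(m+1; ψ) ≤ −q / (|S|² (m+1)²)` — block Cauchy–Schwarz
`|S|² p_d ≤ Σ_{s,s'} P̄_d(s' − s)` (`card_sq_mul_pairFieldDensity_le_sum_avgPairCorr`). A finite-size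
statement (no thermodynamic limit); informative only below the kinematic value. HONEST FRAMING: ladder
R1–R4 with certified numbers; no claim on H/H₀. [cite: Scalapino1995, §2 eq. (2.4)] -/
theorem pairFieldDensity_le_of_sectorListCert (m : ℕ) (t t' U : ℝ) {N : ℕ} {M u q : ℝ}
    (S : Finset (Site 2)) (hS : S.Nonempty) {n : ℕ} (w : Fin n → ℝ) (r : Fin n → Site 2)
    (hrep : ∀ F : Site 2 → ℝ, ∑ s ∈ S, ∑ s' ∈ S, F (s' - s) = ∑ i, w i * F (r i))
    (C : TorusSectorObsCertTT' (m + 1) t t' U N M u (pairListObjective (m + 1) (fun i => -w i) r) q)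
    (hE : (hubbardTorusTT' (m + 1) t t' U).minEnergyOn (szSector N M) ≤ u)
    (ψ : Fock (Orb (FermionTorus 2 (m + 1)))) (hψ1 : star ψ ⬝ᵥ ψ = 1)
    (hgs : IsGroundStateInSector (hubbardTorusTT' (m + 1) t t' U) N M ψ) :
    pairFieldDensity (m + 1) ψ ≤ -q / ((#S : ℝ) ^ 2 * ((m + 1 : ℕ) : ℝ) ^ 2) := by
  have hL2 : (0 : ℝ) < ((m + 1 : ℕ) : ℝ) ^ 2 := by positivity
  have hS2 : (0 : ℝ) < (#S : ℝ) ^ 2 := by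
    have : 0 < #S := Finset.card_pos.2 hS
    positivity
  have h := C.re_expect_ge hE ψ hψ1 hgs
  rw [re_expect_pairListObjective] at h
  have hneg : ∑ i, -w i * avgPairCorr (m + 1) (r i) ψ = -∑ i, w i * avgPairCorr (m + 1) (r i) ψ := by
    rw [← Finset.sum_neg_distrib]
    exact Finset.sum_congr rfl fun i _ => by ring
  rw [hneg, ← hrep (fun x => avgPairCorr (m + 1) x ψ)] at h
  have hcs := card_sq_mul_pairFieldDensity_le_sum_avgPairCorr S (m + 1) ψ
  rw [le_div_iff₀ (mul_pos hS2 hL2)]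
  nlinarith

end Torus

/-! ## §4 Discharging the energy hypothesis from a typed UPPER claim -/

section EnergyGlue

variable {L : ℕ} [NeZero L]

/-- **Upper claim ⇒ energy hypothesis.** The cell's finite-torus UPPER leaves for the `t–t'` model are
typed as `groundEnergy (hubbardRectTorusTT' L L t t' U) N ≤ claim` (rectangular reading, every `S^z`;
e.g. `Bounds.SlaterUpperBounds.slaterUpper_4x4_U8_N14_tpm1o4_uhf`, the T-UP `4 × 4` leaves). For even
`N = 2 nh ≤ 2 L²` such a claim IS the hypothesis `minEnergyOn (hubbardTorusTT' L t t' U) (szSector (2 nh) 0) ≤ u`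
of §2–§3: square ↔ rectangular torus (`groundEnergy_hubbardTorusTT'_eq_rect`) and the `2 nh`-particle
ground energy is attained at `S^z = 0` (`groundEnergy_hubbardTorusTT'_eq_minEnergyOn_szSector`, Lieb 1989).
[cite: LiebPRL1989] -/
theorem minEnergyOn_szSector_le_of_groundEnergy_rect_le (t t' U : ℝ) {nh : ℕ}
    (hn : nh ≤ Fintype.card (FermionTorus 2 L)) {u : ℝ}
    (h : groundEnergy (hubbardRectTorusTT' L L t t' U) (2 * nh) ≤ u) :
    (hubbardTorusTT' L t t' U).minEnergyOn (szSector (2 * nh) 0) ≤ u := by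
  rwa [← groundEnergy_hubbardTorusTT'_eq_rect, groundEnergy_hubbardTorusTT'_eq_minEnergyOn_szSector L t t' U hn]
    at h

/-- The same from a claim in the square-torus reading `groundEnergy (hubbardTorusTT' L t t' U) (2 nh) ≤ u`.
[cite: LiebPRL1989] -/
theorem minEnergyOn_szSector_le_of_groundEnergy_le (t t' U : ℝ) {nh : ℕ}
    (hn : nh ≤ Fintype.card (FermionTorus 2 L)) {u : ℝ}
    (h : groundEnergy (hubbardTorusTT' L t t' U) (2 * nh) ≤ u) :
    (hubbardTorusTT' L t t' U).minEnergyOn (szSector (2 * nh) 0) ≤ u := by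
  rwa [groundEnergy_hubbardTorusTT'_eq_minEnergyOn_szSector L t t' U hn] at h

/-- **The first instance's shape, end to end (no number introduced).** On the `4 × 4` torus at
`t = 1`, `t' = −1/4`, `U = 8`, sector `(14, S^z = 0)`: two single-entry `pair_dd` certificates at
displacement `r` with energy-hypothesis constant `u`, plus ANY typed upper claim
`groundEnergy (hubbardRectTorusTT' 4 4 1 (−1/4) 8) 14 ≤ u`, give the R3 row of record
`PairCorrWindowCert (fun L => hubbardTorusTT' L 1 (−1/4) 8) (fun _ => 14) 4 r` with window `[q₊/16, −q₋/16]`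
(instance `pairrows-N14-min` of R3-PAIRROWS-SPEC §7: `r = (2,2)`; NOT RUN). HONEST FRAMING: ladder R1–R4 with
certified numbers; no claim on H/H₀. [cite: QinEtAl2020, §II eqs. (2)–(4)] -/
def pairCorrWindowCert_4x4_U8_N14_tpm1o4_of_certs (r : Site 2) {u qp qm : ℝ}
    (Cp : TorusSectorObsCertTT' 4 1 ((-1 : ℝ) / 4) 8 14 0 u
      (pairListObjective 4 (fun _ : Fin 1 => (1 : ℝ)) (fun _ => r)) qp)
    (Cm : TorusSectorObsCertTT' 4 1 ((-1 : ℝ) / 4) 8 14 0 u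
      (pairListObjective 4 (fun _ : Fin 1 => (-1 : ℝ)) (fun _ => r)) qm)
    (hup : groundEnergy (hubbardRectTorusTT' 4 4 1 ((-1 : ℝ) / 4) 8) 14 ≤ u) :
    PairCorrWindowCert (fun L => hubbardTorusTT' L 1 ((-1 : ℝ) / 4) 8) (fun _ => 14) 4 r :=
  have hn : 7 ≤ Fintype.card (FermionTorus 2 4) := by
    simp [FermionTorus, Fintype.card_pi]
  have hE : (hubbardTorusTT' 4 1 ((-1 : ℝ) / 4) 8).minEnergyOn (szSector 14 0) ≤ u :=
    minEnergyOn_szSector_le_of_groundEnergy_rect_le (L := 4) 1 ((-1 : ℝ) / 4) 8 (nh := 7) hn hup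
  PairCorrWindowCert.ofSectorPairCerts 3 1 ((-1 : ℝ) / 4) 8 (fun _ => 14) r Cp Cm hE hE

/-- **Calibration against an IN-TREE claim node (format only; no certificate exists).** With the typed
Slater/UHF upper claim `Bounds.slaterUpper_4x4_U8_N14_tpm1o4_uhf`
(`E₀(4 × 4, t' = −1/4, U = 8, N = 14) ≤ −10382063354753 / 2⁴⁰ ≈ −9.442`) as the energy hypothesis, two
single-entry `pair_dd` certificates written with `u := −10382063354753 / 2⁴⁰` give the R3 row. The
certificate's `u` must be the typed node's constant — a tighter typed upper leaf (the T-UP `4 × 4`,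
`t' = −1/4`, `N = 14` claim, once typed) gives a tighter relaxation, but `κ (u' − u)` is not free, so a
file written against `u'` is consumed only with the node for `u'`. HONEST FRAMING: ladder R1–R4 with
certified numbers; no claim on H/H₀. [cite: QinEtAl2020, §II eqs. (2)–(4)] -/
def pairCorrWindowCert_4x4_U8_N14_tpm1o4_of_slaterUpper (r : Site 2) {qp qm : ℝ}
    (Cp : TorusSectorObsCertTT' 4 1 ((-1 : ℝ) / 4) 8 14 0 ((-10382063354753 : ℝ) / 2 ^ 40)
      (pairListObjective 4 (fun _ : Fin 1 => (1 : ℝ)) (fun _ => r)) qp)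
    (Cm : TorusSectorObsCertTT' 4 1 ((-1 : ℝ) / 4) 8 14 0 ((-10382063354753 : ℝ) / 2 ^ 40)
      (pairListObjective 4 (fun _ : Fin 1 => (-1 : ℝ)) (fun _ => r)) qm)
    (hup : Bounds.slaterUpper_4x4_U8_N14_tpm1o4_uhf) :
    PairCorrWindowCert (fun L => hubbardTorusTT' L 1 ((-1 : ℝ) / 4) 8) (fun _ => 14) 4 r :=
  pairCorrWindowCert_4x4_U8_N14_tpm1o4_of_certs r Cp Cm hup

end EnergyGlue

end Summit.HubbardSuperconductivity.HubbardLadder
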